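import Literature.MathematicalPhysics.QuantumLattice.SchwingerOSAxioms
import Literature.MathematicalPhysics.QuantumLattice.GaugeGroups
import Literature.MathematicalPhysics.QuantumLattice.ContinuumLimitLGT
import Literature.MathematicalPhysics.QuantumLattice.MinkowskiGeometry
import Literature.MathematicalPhysics.QuantumLattice.WightmanAxioms
import Literature.MathematicalPhysics.QuantumLattice.SchwingerWightman
import Literature.MathematicalPhysics.QuantumFieldTheory.YangMillsEuclidean
import Mathlib.Analysis.Complex.CauchyIntegral
import Mathlib.Analysis.Analytic.IsolatedZeros
import Mathlib.Analysis.Distribution.AEEqOfIntegralContDiff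
import Mathlib.Analysis.Convex.PathConnected
import HarnessLib
import HarnessLib.Audit

-- provenance: harness21/H21/H21/Statements/ConstructiveQFT/Wightman.lean @ f4ae3c6 (interim HEAD d8f2665); M5 mechanical rewrite
/-!
# Wightman QFT: the axioms, OS reconstruction, and the Clay Yang–Mills problem

Family `constructive-qft`, trunk G13 (`QLatticeAQFT`), statements file `Wightman` (tier L;
outline `H21/Outlines/QLatticeAQFT.md`, items cqft.S05 (= constructive-qft.S05), cqft.S02
(= constructive-qft.S02), cqft.S04 (= constructive-qft.S04); below `cqft.Sxx` always abbreviates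
the inventory id `constructive-qft.Sxx`; design decisions A-D3 / review F4 (torus-primary
continuum limits), A-D4/A-D5 (Wightman data as a hypothesis structure), A6 / review F12e (E0' a
separate hypothesis)).

## Informal content

* **constructive-qft.S05** (definition; Streater–Wightman, *PCT, Spin and Statistics, and All
  That* (1964) §3-1; Jaffe–Witten, *Quantum Yang–Mills theory* (2000) §5). The Wightman axioms
  W0 (relativistic quantum theory: Hilbert space, unitary representation of the Poincaré group,
  spectral condition, unique vacuum), W1 (fields are operator-valued tempered distributions on a
  common dense invariant domain), W2 (Poincaré covariance), W3 (locality), W4 (cyclicity of the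
  vacuum). In H21 these are the fields of the `Prop`-valued structure `Literature.IsWightmanQFT W` for
  `W : Literature.WightmanData d κ` (prelude `WightmanAxioms`); the id is carried here by the
  consequence "the Wightman functions are Poincaré invariant"
  (`IsWightmanQFT.wightmanFn_covariant`).
* **constructive-qft.S02** (flag = the Clay problem; Jaffe–Witten (2000), statement p. 6). "For
  every compact simple Lie group `G` there is a *non-trivial* quantum Yang–Mills theory on `ℝ⁴`
  satisfying the Wightman axioms W0–W4 whose Hamiltonian has spectrum in `{0} ∪ [Δ, ∞)`, `Δ > 0`,
  with a unique vacuum." Open: `def ClayYangMills : Prop` only, never asserted.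
* **constructive-qft.S04** (known theorem; Osterwalder–Schrader, CMP 31 (1973) Thm. E→R, CMP 42
  (1975) §IV.1, Theorem E' (or E'')→R', p. 287; Glimm–Jaffe, *Quantum Physics* (1987) Thm. 6.1.3
  and §19.1).
  "Schwinger
  functions satisfying E0–E4 together with the linear growth condition E0' are the Euclidean
  continuation of the Wightman distributions of a unique Wightman QFT." Here `os_reconstruction`
  (E→R) and `wightman_to_schwinger` (R→E, OS I §4).

## H21's reading of "a quantum Yang–Mills theory" (S02)

The Clay text asks for a Wightman theory that *is* quantum Yang–Mills with gauge group `G`. H21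
reads this (outline §A, cqft.S02; review F4) as `IsYangMillsQuantisation ρ hρ W`: there are a
scaling scheme `sch`, a probability measure `μ` on `𝒮'(ℝ⁴)` which is the continuum limit in law
of the smeared renormalised plaquette fields `Re tr ρ(U_p)` under the **concrete torus Wilson
measures** `wilsonMeasure (L := sch.side a) ρ (sch.β a)` (`HasLocalFieldContinuumLimit`,
torus-primary, exactly as in `ClayYangMillsEuclidean(Gap)`), which is a **non-trivial Euclidean
limit**, i.e. not Gaussian (`IsNonGaussian μ`, as in the sibling flags cqft.S01/S03 — without it
the trivial theory `H = ℂ`, `φ = 0`, `μ = δ₀` obtained from the scheme `c ≡ 0` would witness the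
flag) and has **all moments** (`HasAllMoments μ`; the prelude's `moment μ n f` is a Bochner
integral with junk value `0`, so without this guard `IsSchwingerFamilyOf μ S` would not tie `S`
to `μ`), a Schwinger family `S` of `μ` (`IsSchwingerFamilyOf`, then unique by
`existsUnique_schwingerFamilyOf`), and field labels `k`, such that `S` is the Wick rotation of
`W` (`IsWickRotationOf`, prelude `SchwingerWightman`). Then `ClayYangMills` quantifies over
compact simple `G` with a faithful continuous unitary matrix representation `ρ` with the same
binders as `ClayYangMillsEuclideanGap` (S03). (Identifier spelling `Quantisation` and the name
`clayYangMills_imp_euclideanGap` follow the architect's outline.)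

*Known limitation of this reading (for the architect; not fixable in this item).*
`IsNonGaussian μ` makes the *Euclidean* limit non-trivial, but `IsWickRotationOf S W k`
constrains `S` only on time-ordered (non-coincident) Euclidean test functions; an ultralocal
non-Gaussian limit `μ` (supported on coincident points, e.g. a non-Gaussian white noise) would
therefore still be "the Wick rotation" of the trivial Wightman theory. Excluding this requires a
sharper prelude notion of Wick rotation / Yang–Mills quantisation, shared with cqft.S01/S03.

## Mathlib / H21 search

Mathlib (pinned commit) has no Wightman axioms, Schwinger functions, Osterwalder–Schrader
reconstruction or Yang–Mills vocabulary (`lean_search` for `Wightman`, `Osterwalder`,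
`Schwinger`, `YangMills` in Mathlib: no hits). Everything below is assembled from the accepted
H21 preludes: `WightmanData`, `IsWightmanQFT`, `wightmanFn`, `HasMassGap`,
`IsUnitarilyEquivalent` (`WightmanAxioms`); `IsWickRotationOf`, `IsWightmanDistributionOf`
(`SchwingerWightman`); `SchwingerFamily`, `IsSchwingerFamilyOf`, `IsOSFamily`, `HasLinearGrowth`
(`SchwartzTensor`, `SchwingerOSAxioms`); `ScalingScheme`, `plaquetteObservable`,
`HasLocalFieldContinuumLimit` (`ContinuumLimitLGT`); `IsSimpleCompactGroup` (`GaugeGroups`);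
`poincareTest`, `poincareTestMulti`, `PoincareGroup` (`MinkowskiGeometry`); and the
second-countability instances on matrix groups from the statements file `YangMillsEuclidean`
(needed to form `plaquetteObservable` for an abstract compact `G` with a faithful `ρ`).

## Design choices

* `ℝ⁴` is `EuclideanSpace ℝ (Fin 4)` and `ℝ^{d+1}` is `EuclideanSpace ℝ (Fin (d + 1))`, written
  out; Minkowski space is the prelude's `SpaceTime d` (the same type, time = coordinate `0`).
* **S05.** The prelude already proves Poincaré invariance of the smeared Wightman functions
  (`IsWightmanQFT.wightmanFn_poincare_invariant`); the id-carrying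
  `IsWightmanQFT.wightmanFn_covariant` (name fixed by the outline; it is a re-export of the
  prelude lemma and states *invariance*) restates it (real proof) and
  `IsWightmanQFT.wightmanDistribution_poincare_invariant` gives the distributional form
  `𝔚ₙ(g • F) = 𝔚ₙ(F)` for the `n`-point Wightman distribution (nuclear theorem + density of
  tensor products; sorried, known). Both are deliberate dot-notation extensions of the prelude
  namespace `Literature.MathematicalPhysics.QuantumLattice.IsWightmanQFT`.
* **S04, uniqueness.** `WightmanData.IsUnitarilyEquivalent` asks the unitary to map the chosen
  domain `D` *onto* `D'`, so uniqueness can only hold among data whose domain is the canonical one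
  produced by the reconstruction, the *polynomial domain* `D₀ = span {φ(f₁)⋯φ(fₙ) Ω}`
  (Streater–Wightman Thm. 3-7; OS I §4). We define `WightmanData.HasPolynomialDomain` (a
  dot-notation extension of the prelude namespace `Literature.MathematicalPhysics.QuantumLattice.WightmanData`) and state: the
  reconstructed `W` has polynomial domain, and any Wightman `W'` with polynomial domain and the
  same Wick rotation is unitarily equivalent to `W`. The label type is `Unit` (one hermitian
  scalar field), the labels are `fun _ _ => ()`. E0' (`HasLinearGrowth`) is a separate hypothesis
  next to `IsOSFamily` (F12e). We assume `[NeZero d]` (at least one space dimension): for `d = 0`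
  the cluster property E4 is vacuous in H21's rendering and uniqueness of the vacuum would fail.
* **R→E.** `wightman_to_schwinger` asserts only the existence of a Schwinger family that is the
  Wick rotation of `W` (OS I §4, (4.12)–(4.14): analytic continuation into the forward tube,
  Streater–Wightman Thm. 3-5, restriction to Euclidean points, temperedness on `𝒮_<` and
  extension to `𝒮`). OS I prove E0–E4 for these Schwinger functions on the space `⁰𝒮` of test
  functions vanishing at coincident points and with E1 for `SO(4)`; H21's `IsOSFamily` is
  formulated on all of `𝒮` with full `O(d+1)` invariance (Glimm–Jaffe convention), which a general
  (possibly parity-violating) Wightman theory need not satisfy, so it is *not* asserted.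
* **S02.** Open problem: `def ClayYangMills : Prop`. Non-triviality ("non-trivial quantum
  Yang–Mills theory", Jaffe–Witten p. 6) is the conjunct `IsNonGaussian μ` inside
  `IsYangMillsQuantisation`, matching cqft.S01/S03 (non-triviality of the Euclidean limit; see
  the limitation recorded above), and `HasAllMoments μ` guards the junk-valued moments. The only
  theorem about it is the sanity repackaging `clayYangMills_imp_euclideanGap` (real proof): the
  non-Gaussian Euclidean continuum limit `μ` produced by `ClayYangMills` admits a gapped
  Osterwalder–Schrader reconstruction (`HasMassGap Δ` already contains `0 < Δ`).
* Imports: `OSAxiomsMeasure` (listed by the outline) is imported transitively through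
  `YangMillsEuclidean` and not repeated.

## Discharged facts (appended)

* `ConstructiveQFT.wightmanFn_eq_of_isWickRotationOf_holds` proves the named fact
  `ConstructiveQFT.wightmanFn_eq_of_isWickRotationOf` (uniqueness of the Wightman functions
  with a given Wick rotation; OS I §4, Streater–Wightman §2-3/§3-4). Proof (last section of the
  file): (1) two functions continuous on the open time-ordered region
  `Ω_< = {0 < x₀⁰ < ⋯ < x_{n-1}⁰}` with equal integrals against all time-ordered test functions
  agree on `Ω_<` (smooth bump functions are Schwartz, Mathlib
  `IsOpen.ae_eq_zero_of_integral_contDiff_smul_eq_zero`, and Lebesgue measure charges open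
  sets); (2) *the time-ordered Euclidean points are a set of uniqueness for the forward tube*
  (`eqOn_zero_forwardTube_of_euclidean`): every `z ∈ 𝒯ₙ` is `p + i q` with `p, q` Euclidean
  points, `p` time-ordered (its times are the successive imaginary parts of `z⁰`), the tube is
  convex (`convex_forwardTube`), and the one-variable identity theorem on the complex line
  `t ↦ p + t q` (which meets the Euclidean points in a real interval around `t = 0` and contains
  `z` at `t = i`) gives `g z = 0` — no several-variable identity theorem is needed;
  (3) distributional boundary values depend only on the values on the tube
  (`HasDistributionalBoundaryValue.eq_of_eqOn`, uniqueness of limits along `t → 0⁺`);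
  (4) tensor test functions exist (`AQFT.exists_isTensorOf`). Extra imports for this section:
  `Mathlib.Analysis.Complex.CauchyIntegral`, `Mathlib.Analysis.Analytic.IsolatedZeros`,
  `Mathlib.Analysis.Distribution.AEEqOfIntegralContDiff`, `Mathlib.Analysis.Convex.PathConnected`.
-/

noncomputable section

open MeasureTheory Filter Topology
open scoped InnerProductSpace SchwartzMap
open Literature.MathematicalPhysics.QuantumLattice Literature.MathematicalPhysics.QuantumFieldTheory

namespace Literature.MathematicalPhysics.QuantumFieldTheory

/-! ### constructive-qft.S05: the Wightman axioms (definition role) -/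

section IsWightmanQFT
open Literature.MathematicalPhysics.QuantumLattice (IsWightmanQFT)
open Literature.MathematicalPhysics.QuantumLattice.IsWightmanQFT

variable {d : ℕ} {κ : Type*} {W : WightmanData d κ}

/-- **constructive-qft.S05** (definition; Streater–Wightman (1964) §3-1, §3-3 eq. (3-21);
Jaffe–Witten (2000) §5). *The Wightman axioms and Poincaré invariance of the Wightman functions.*
H21 renders the Wightman axioms for hermitian scalar fields `φ_k`, `k : κ`, on `ℝ^{1+d}` as the
`Prop`-structure `IsWightmanQFT W` on `W : WightmanData d κ`:

* **W0** (relativistic quantum theory): Hilbert space `W.H`; unitary representation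
  `U(a, Λ) = transl a * lor Λ` of the restricted Poincaré group `ℝ^{1+d} ⋊ L↑₊` (fields
  `strongCont_lor`, `lor_transl`); spectral condition `spectral` (energy–momentum spectrum in the
  closed forward cone); unique, Lorentz-invariant, normalised vacuum `Ω` (`uniqueVacuum`,
  `lor_vacuum`, `norm_vacuum`);
* **W1** (fields): dense common domain `D ∋ Ω` invariant under `U` (`dense_dom`, `transl_dom`,
  `lor_dom`), `f ↦ ⟪χ, φ_k(f) ψ⟫` tempered (`tempered`), hermiticity `φ_k(f)* ⊇ φ_k(f̄)`
  (`hermitian`);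
* **W2** (covariance): `U(g) φ_k(f) U(g)⁻¹ = φ_k(g • f)`, `(g • f)(x) = f(Λ⁻¹(x − a))`
  (`covariant`);
* **W3** (locality): `[φ_k(f), φ_{k'}(g)] = 0` on `D` for spacelike separated supports
  (`locality`);
* **W4** (cyclicity of the vacuum): polynomials in the fields applied to `Ω` are dense (`cyclic`).

Consequence stated here (from W0–W2): the smeared Wightman functions
`𝔚ₙ(f₁, …, fₙ) = ⟪Ω, φ_{k₁}(f₁) ⋯ φ_{kₙ}(fₙ) Ω⟫` are invariant under the restricted Poincaré
group, `𝔚ₙ(g • f₁, …, g • fₙ) = 𝔚ₙ(f₁, …, fₙ)`. This is a re-export, under the outline's name,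
of the prelude lemma `IsWightmanQFT.wightmanFn_poincare_invariant`. (Scope, outline R10: true
representations of `L↑₊` only, no spinors / `SL(2, ℂ)` cover.) [cite: StreaterWightman1964] -/
theorem _root_.Literature.MathematicalPhysics.QuantumLattice.IsWightmanQFT.wightmanFn_covariant (hW : IsWightmanQFT W) (g : PoincareGroup d) (n : ℕ)
    (k : Fin n → κ) (f : Fin n → 𝓢(SpaceTime d, ℂ)) :
    W.wightmanFn n k (fun i => poincareTest g (f i)) = W.wightmanFn n k f :=
  hW.wightmanFn_poincare_invariant n k f g

/-- **Poincaré invariance of the Wightman distributions** (Streater–Wightman (1964) §3-3,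
eq. (3-21), property (a) of the Wightman distributions): if `T ∈ 𝒮'((ℝ^{1+d})^n)` is the
`n`-point Wightman distribution of `W` with labels `k` (`IsWightmanDistributionOf`, i.e.
`T(f₁ ⊗ ⋯ ⊗ fₙ) = 𝔚ₙ(f₁, …, fₙ)`), then `T(g • F) = T(F)` for every test function `F` of `n`
space-time arguments and every `g` in the restricted Poincaré group, `(g • F)(x) =
F(g⁻¹ x₁, …, g⁻¹ xₙ)` (`poincareTestMulti`). From `wightmanFn_covariant` on tensor products, the
density of their span in `𝓢` and continuity of `T`. Known; proof deferred. [cite: StreaterWightman1964] -/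
def _root_.Literature.MathematicalPhysics.QuantumLattice.IsWightmanQFT.wightmanDistribution_poincare_invariant : Prop :=
  ∀ (hW : IsWightmanQFT W) {n : ℕ} {k : Fin n → κ} {T : 𝓢((Fin n → SpaceTime d), ℂ) →L[ℂ] ℂ} (hT : IsWightmanDistributionOf W n k T) (g : PoincareGroup d) (F : 𝓢((Fin n → SpaceTime d), ℂ)),
    T (poincareTestMulti n g F) = T F

end IsWightmanQFT

/-! ### The polynomial domain -/

section WightmanData
open Literature.MathematicalPhysics.QuantumLattice (WightmanData)
open Literature.MathematicalPhysics.QuantumLattice.WightmanData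

variable {d : ℕ} {κ : Type*}

/-- The **polynomial domain** `D₀ ⊆ H` of Wightman data: the linear span of the vectors
`φ_{k₁}(f₁) ⋯ φ_{kₙ}(fₙ) Ω` (Streater–Wightman (1964) §3-4, the domain produced by the
reconstruction theorem, Thm. 3-7; Osterwalder–Schrader I (1973) §4). W4 says `D₀` is dense. [cite: StreaterWightman1964] -/
def _root_.Literature.MathematicalPhysics.QuantumLattice.WightmanData.polynomialDomain (W : WightmanData d κ) : Submodule ℂ W.H :=
  Submodule.span ℂ (Set.range fun l : List (κ × 𝓢(SpaceTime d, ℂ)) =>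
    (W.fieldMonomial l W.vacuumDom : W.H))

/-- The vacuum lies in the polynomial domain (empty monomial). [folklore] -/
theorem _root_.Literature.MathematicalPhysics.QuantumLattice.WightmanData.vacuum_mem_polynomialDomain (W : WightmanData d κ) : W.vacuum ∈ W.polynomialDomain :=
  Submodule.subset_span ⟨[], by simp⟩

/-- The polynomial domain is contained in the domain `D` (each monomial maps `D → D`). [folklore] -/
theorem _root_.Literature.MathematicalPhysics.QuantumLattice.WightmanData.polynomialDomain_le_dom (W : WightmanData d κ) : W.polynomialDomain ≤ W.dom := by
  refine Submodule.span_le.2 ?_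
  rintro _ ⟨l, rfl⟩
  exact (W.fieldMonomial l W.vacuumDom).2

/-- The Wightman data have **polynomial domain**: the chosen common domain `D` *is* the
polynomial domain `D₀ = span {φ(f₁) ⋯ φ(fₙ) Ω}`. This is the normal form produced by the Wightman
and Osterwalder–Schrader reconstruction theorems, and the class within which reconstructed data
are unique up to unitary equivalence (Streater–Wightman (1964) Thm. 3-7; OS I (1973) §4). [cite: StreaterWightman1964] -/
def _root_.Literature.MathematicalPhysics.QuantumLattice.WightmanData.HasPolynomialDomain (W : WightmanData d κ) : Prop :=
  W.dom = W.polynomialDomain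

end WightmanData

/-- W4 (cyclicity of the vacuum, Streater–Wightman (1964) §3-1) says precisely that the
polynomial domain `D₀` is dense in `H`. [cite: StreaterWightman1964] -/
theorem _root_.Literature.MathematicalPhysics.QuantumLattice.IsWightmanQFT.dense_polynomialDomain {d : ℕ} {κ : Type*} {W : WightmanData d κ}
    (hW : IsWightmanQFT W) : Dense (W.polynomialDomain : Set W.H) :=
  hW.cyclic

end Literature.MathematicalPhysics.QuantumFieldTheory

namespace Literature.MathematicalPhysics.QuantumFieldTheory

/-! ### constructive-qft.S04: Osterwalder–Schrader reconstruction -/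

/-- **constructive-qft.S04** (known theorem; Osterwalder–Schrader, *Axioms for Euclidean Green's
functions*, CMP 31 (1973), Thm. E→R and §4; *… II*, CMP 42 (1975), §IV.1, Theorem E' (or E'')→R',
p. 287: "a) A sequence of distributions `{𝔖ₙ}` satisfying E0' (or E0'') and E1–E4 is the sequence
of Euclidean Green's functions of a uniquely determined Wightman quantum field theory. b) The
Wightman distributions of that theory satisfy all the Wightman axioms R0–R5 and in addition
[the linear growth condition] R0'" — printed for `ℝ⁴`, one real scalar field, `𝔖ₙ ∈ ⁰𝒮'`, the
arguments being independent of the dimension; the decomposition of its proof in this tree is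
`Literature.MathematicalPhysics.QuantumFieldTheory.os_reconstruction_of_remaining'`,
`WightmanProofs`; Glimm–Jaffe, *Quantum Physics* (1987), Thm. 6.1.3, §19.1). *OS reconstruction.* Let `S = (𝔖ₙ)ₙ` be a
Schwinger family on Euclidean `ℝ^{d+1}` (`d ≥ 1` space dimensions) satisfying the
Osterwalder–Schrader axioms `𝔖₀ = 1`, E1–E4 (`IsOSFamily`) **and, separately, the linear growth
condition E0'** (`HasLinearGrowth`, OS II; review F12e). Then there is a Wightman QFT `W` of one
hermitian scalar field (`κ = Unit`) on `(d+1)`-dimensional Minkowski space, with the polynomial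
domain `D₀ = span {φ(f₁)⋯φ(fₙ) Ω}` as its domain, whose Wightman distributions continue
analytically into the forward tube and restrict at Euclidean points to `S`
(`IsWickRotationOf S W _`); and `W` is unique up to unitary equivalence among Wightman QFTs with
polynomial domain having `S` as Wick rotation. Proof deferred (OS II). [cite: OsterwalderSchraderCMP1975, §IV.1 Theorem E'→R' (p. 287), reconstruction with uniqueness] [cite: OsterwalderSchraderCMP1973, Thm. E→R] [cite: GlimmJaffeQP1987, Thm. 6.1.3 and §19.1] -/
def os_reconstruction : Prop :=
  ∀ (d : ℕ) [NeZero d] (S : SchwingerFamily (EuclideanSpace ℝ (Fin (d + 1)))) (hS : S.IsOSFamily) (hE0' : S.HasLinearGrowth),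
    ∃ W : WightmanData d Unit, IsWightmanQFT W ∧ W.HasPolynomialDomain ∧
      IsWickRotationOf S W (fun _ _ => ()) ∧
      ∀ W' : WightmanData d Unit, IsWightmanQFT W' → W'.HasPolynomialDomain →
        IsWickRotationOf S W' (fun _ _ => ()) → W.IsUnitarilyEquivalent W'

/-- *OS reconstruction, uniqueness of the Wightman functions* (Osterwalder–Schrader I (1973) §4,
(4.12)–(4.14); Streater–Wightman (1964) Thm. 3-5, §3-4): two Wightman QFTs of one scalar field
having the same Schwinger family as Wick rotation have the same smeared Wightman functions (the
holomorphic continuation is determined by its values at time-ordered Euclidean points, a set of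
uniqueness in the forward tube, and determines its boundary value). No domain condition and no
Wightman axiom is needed here: `IsWickRotationOf` already contains the forward-tube
continuation, so the statement holds for raw `WightmanData`. Known; proof deferred. [cite: StreaterWightman1964] -/
def wightmanFn_eq_of_isWickRotationOf : Prop :=
  ∀ {d : ℕ} {S : SchwingerFamily (EuclideanSpace ℝ (Fin (d + 1)))} {W W' : WightmanData d Unit} (h : IsWickRotationOf S W (fun _ _ => ())) (h' : IsWickRotationOf S W' (fun _ _ => ())) (n : ℕ) (f : Fin n → 𝓢(SpaceTime d, ℂ)),
    W.wightmanFn n (fun _ => ()) f = W'.wightmanFn n (fun _ => ()) f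

/-- *From Wightman to Schwinger functions* (the direction R→E; Osterwalder–Schrader I (1973) §4,
eqs. (4.12)–(4.14); Streater–Wightman (1964) Thm. 3-5 and §3-4; Glimm–Jaffe (1987) §19.5). For a
Wightman QFT `W` and any choice of field labels `k n : Fin n → κ`, the Wightman distributions
`𝔚ₙ` are boundary values of functions holomorphic in the forward tube `𝒯ₙ` (spectral
condition), and their values at Euclidean points `(i x_k⁰, x⃗_k)`, `0 < x₁⁰ < ⋯ < xₙ⁰`, define
tempered distributions: there is a Schwinger family `S` on `ℝ^{d+1}` which is the Wick rotation
of `W`. (OS I moreover show that these Schwinger functions satisfy E0–E4 on the test-function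
space `⁰𝒮` of functions vanishing at coincident points, with `SO(d+1)` invariance; H21's
`IsOSFamily` lives on all of `𝒮` with `O(d+1)` invariance and is not asserted here — see the
module docstring.) Known; proof deferred. [cite: StreaterWightman1964] -/
def wightman_to_schwinger : Prop :=
  ∀ {d : ℕ} {κ : Type*} {W : WightmanData d κ} (hW : IsWightmanQFT W) (k : (n : ℕ) → Fin n → κ),
    ∃ S : SchwingerFamily (EuclideanSpace ℝ (Fin (d + 1))), IsWickRotationOf S W k

/-! ### constructive-qft.S02: the Clay Yang–Mills problem (Wightman + mass gap) -/

section YangMills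

variable {G : Type*} [Group G] [TopologicalSpace G] [IsTopologicalGroup G] [CompactSpace G]
  [MeasurableSpace G] [BorelSpace G] [SecondCountableTopology G] {N : ℕ}

/-- The Wightman data `W` on `4`-dimensional Minkowski space are **a quantisation of Yang–Mills
theory with gauge group `G`** (in the representation `ρ`) — H21's reading of "quantum Yang–Mills
theory on `ℝ⁴`" in the Clay problem (Jaffe–Witten (2000) §5 with §6; outline cqft.S02, review
F4): there are

* a scaling scheme `sch` (bare coupling `β(a)`, field renormalisation `c(a)`, counterterm `m(a)`,
  tori of side `2 L(a) + 1` with `a L(a) → ∞`) and a probability measure `μ` on `𝒮'(ℝ⁴)` which is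
  the continuum limit in law, as `a → 0⁺`, of the smeared renormalised plaquette fields
  `Re tr ρ(U_p)` (`(0, 1)` plane) under the **concrete torus Wilson measures**
  `wilsonMeasure (L := sch.side a) ρ (sch.β a)` (`HasLocalFieldContinuumLimit`, torus-primary),
  and which is a **non-trivial Euclidean limit**, i.e. not a Gaussian measure (`IsNonGaussian μ`;
  Jaffe–Witten's "non-trivial quantum Yang–Mills theory", p. 6, and the same conjunct as in the
  sibling flags `ClayYangMillsEuclidean(Gap)`, cqft.S01/S03 — it rules out the free/zero
  Euclidean field, in particular the degenerate limit `μ = δ₀` produced by the renormalisation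
  `c ≡ 0`; see the module docstring for what it does *not* rule out);
* all moments of `μ` (`HasAllMoments μ`: the moments `∫ ∏ᵢ ω(fᵢ) dμ` are genuine Bochner
  integrals, not junk values, so that the next conjunct pins `S` down — `S` is then *the*
  Schwinger family of `μ`, `existsUnique_schwingerFamilyOf`);
* a Schwinger family `S` on `ℝ⁴` reproducing the moments of `μ` (`IsSchwingerFamilyOf`);
* field labels `k n : Fin n → κ`,

such that `S` is the Wick rotation of `W` (`IsWickRotationOf`: the Wightman distributions of `W`
continue into the forward tube and restrict at Euclidean points to `S`). The hypothesis
`hρ : Continuous ρ` is needed to form the plaquette observable. [cite: JaffeWitten2000] -/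
def IsYangMillsQuantisation (ρ : G →* Matrix (Fin N) (Fin N) ℂ) (hρ : Continuous ρ)
    {κ : Type*} (W : WightmanData 3 κ) : Prop :=
  ∃ (sch : ScalingScheme) (μ : Measure (FieldConfig (EuclideanSpace ℝ (Fin 4))))
    (S : SchwingerFamily (EuclideanSpace ℝ (Fin 4))) (k : (n : ℕ) → Fin n → κ),
    HasLocalFieldContinuumLimit ρ sch (plaquetteObservable ρ hρ 0 1) μ ∧ IsNonGaussian μ ∧
      HasAllMoments μ ∧ IsSchwingerFamilyOf μ S ∧ IsWickRotationOf S W k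

/-- A Yang–Mills quantisation comes with a non-Gaussian continuum limit `μ` with all moments and an
Osterwalder–Schrader reconstruction datum for its Schwinger family whenever `W` satisfies the
Wightman axioms (repackaging into the prelude's `OSReconstruction`). [folklore] -/
theorem IsYangMillsQuantisation.nonempty_osReconstruction
    {ρ : G →* Matrix (Fin N) (Fin N) ℂ} {hρ : Continuous ρ} {κ : Type*} {W : WightmanData 3 κ}
    (h : IsYangMillsQuantisation ρ hρ W) (hW : IsWightmanQFT W) :
    ∃ (sch : ScalingScheme) (μ : Measure (FieldConfig (EuclideanSpace ℝ (Fin 4))))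
      (S : SchwingerFamily (EuclideanSpace ℝ (Fin 4))),
      HasLocalFieldContinuumLimit ρ sch (plaquetteObservable ρ hρ 0 1) μ ∧ IsNonGaussian μ ∧
        HasAllMoments μ ∧ IsSchwingerFamilyOf μ S ∧ Nonempty (OSReconstruction S κ) := by
  obtain ⟨sch, μ, S, k, hlim, hng, hmom, hS, hwick⟩ := h
  exact ⟨sch, μ, S, hlim, hng, hmom, hS, ⟨⟨W, hW, k, hwick⟩⟩⟩

end YangMills

/-- **constructive-qft.S02** (flag — the Clay Millennium problem; Jaffe–Witten, *Quantum
Yang–Mills theory* (2000), statement p. 6 and §5; summits/ym/SUMMIT.md). *Yang–Mills existence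
and mass gap.* For every compact Hausdorff simple group `G` (`IsSimpleCompactGroup G`: connected,
non-abelian, no proper closed connected normal subgroup) with a faithful continuous unitary
matrix representation `ρ : G →* M_N(ℂ)` (so `G` is a compact simple Lie group; binders as in
`ClayYangMillsEuclideanGap`, cqft.S03), there is a *non-trivial* quantum Yang–Mills theory with
a mass gap: a label type `κ`, Wightman data `W` on `4`-dimensional Minkowski space and `Δ : ℝ`
such that

* `W` satisfies the Wightman axioms W0–W4 (`IsWightmanQFT`, cqft.S05);
* `W` has mass gap `Δ`: the vacuum is the unique translation-invariant vector and the Hamiltonian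
  `H` of the time translations `U(t e₀) = e^{itH}` satisfies `H ≥ 0`, `H Ω = 0`, `0` simple,
  `σ(H) ∖ {0} ⊆ [Δ, ∞)`, `Δ > 0` (`WightmanData.HasMassGap`);
* `W` is a non-trivial quantisation of `G`-Yang–Mills theory in H21's reading
  (`IsYangMillsQuantisation`: non-Gaussian torus-primary continuum limit of lattice `G`-gauge
  theory whose Schwinger functions are the Wick rotation of `W`).

Second countability of `G` (needed to form the plaquette field) is derived from faithfulness of
`ρ`. **Open problem**: `def … : Prop` only, not asserted. [folklore] -/
@[conjecture] def ClayYangMills : Prop :=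
  ∀ (G : Type) [Group G] [TopologicalSpace G] [IsTopologicalGroup G] [CompactSpace G]
    [T2Space G] [MeasurableSpace G] [BorelSpace G] (N : ℕ) (ρ : G →* Matrix (Fin N) (Fin N) ℂ),
    IsSimpleCompactGroup G → ∀ (hρ : Continuous ρ) (hinj : Function.Injective ρ),
      (∀ g, ρ g ∈ Matrix.unitaryGroup (Fin N) ℂ) →
        haveI : SecondCountableTopology G :=
          (hρ.isClosedEmbedding hinj).isEmbedding.secondCountableTopology
        ∃ (κ : Type) (W : WightmanData 3 κ) (Δ : ℝ),
          IsWightmanQFT W ∧ W.HasMassGap Δ ∧ IsYangMillsQuantisation ρ hρ W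

/-- *Sanity repackaging of S02 on the Euclidean side.* `ClayYangMills` yields, for every admissible
`(G, ρ)`, a scaling scheme and a non-Gaussian probability measure `μ` on `𝒮'(ℝ⁴)`,
torus-primary continuum limit of the plaquette fields of lattice `G`-gauge theory, together with
a Schwinger family `S` of `μ` which is the Wick rotation of a Wightman QFT with a mass gap
`Δ > 0` — i.e. the non-trivial Euclidean continuum limit admits a *gapped* Osterwalder–Schrader
reconstruction (a genuine sibling of `ClayYangMillsEuclideanGap`, cqft.S03, where the gap is
expressed by exponential clustering of `μ`; the passage between the two is cqft.S10 and is not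
claimed here). Real proof (unpacking). [folklore] -/
theorem clayYangMills_imp_euclideanGap (h : ClayYangMills) (G : Type) [Group G]
    [TopologicalSpace G] [IsTopologicalGroup G] [CompactSpace G] [T2Space G] [MeasurableSpace G]
    [BorelSpace G] (N : ℕ) (ρ : G →* Matrix (Fin N) (Fin N) ℂ) (hG : IsSimpleCompactGroup G)
    (hρ : Continuous ρ) (hinj : Function.Injective ρ)
    (hunit : ∀ g, ρ g ∈ Matrix.unitaryGroup (Fin N) ℂ) :
    haveI : SecondCountableTopology G :=
      (hρ.isClosedEmbedding hinj).isEmbedding.secondCountableTopology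
    ∃ (sch : ScalingScheme) (μ : Measure (FieldConfig (EuclideanSpace ℝ (Fin 4))))
      (S : SchwingerFamily (EuclideanSpace ℝ (Fin 4))),
      HasLocalFieldContinuumLimit ρ sch (plaquetteObservable ρ hρ 0 1) μ ∧ IsNonGaussian μ ∧
        HasAllMoments μ ∧ IsSchwingerFamilyOf μ S ∧
        ∃ (κ : Type) (W : WightmanData 3 κ) (k : (n : ℕ) → Fin n → κ) (Δ : ℝ),
          IsWightmanQFT W ∧ IsWickRotationOf S W k ∧ W.HasMassGap Δ := by
  obtain ⟨κ, W, Δ, hW, hgap, sch, μ, S, k, hlim, hng, hmom, hS, hwick⟩ :=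
    h G N ρ hG hρ hinj hunit
  exact ⟨sch, μ, S, hlim, hng, hmom, hS, κ, W, k, Δ, hW, hwick, hgap⟩

end Literature.MathematicalPhysics.QuantumFieldTheory


/-! ## Discharged facts

### Geometry of the forward tube: convexity, the time-ordered region, Euclidean coordinates -/

open Complex

namespace Literature.MathematicalPhysics.QuantumFieldTheory

variable {d n : ℕ}

/-- The open forward cone `V₊ = {‖p⃗‖ < p⁰}` is convex. [folklore] -/
theorem convex_forwardCone : Convex ℝ (forwardCone d) := by
  refine convex_iff_forall_pos.2 fun p hp q hq a b ha hb hab => ?_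
  rw [mem_forwardCone_iff_norm_lt] at hp hq ⊢
  calc ‖spaceC d (a • p + b • q)‖ = ‖a • spaceC d p + b • spaceC d q‖ := by
        rw [map_add, map_smul, map_smul]
    _ ≤ a * ‖spaceC d p‖ + b * ‖spaceC d q‖ := by
        refine (norm_add_le _ _).trans ?_
        rw [norm_smul, norm_smul, Real.norm_of_nonneg ha.le, Real.norm_of_nonneg hb.le]
    _ < a * p 0 + b * q 0 :=
        add_lt_add (mul_lt_mul_of_pos_left hp ha) (mul_lt_mul_of_pos_left hq hb)
    _ = (a • p + b • q) 0 := by simp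

/-- `imPart` commutes with real scalars. [folklore] -/
theorem imPart_smul_real (a : ℝ) (z : Fin (d + 1) → ℂ) : imPart (a • z) = a • imPart z := by
  ext μ; simp

/-- `succDiff` is additive. [folklore] -/
theorem succDiff_add {α : Type*} [AddCommGroup α] (x y : Fin n → α) (k : Fin n) :
    succDiff (x + y) k = succDiff x k + succDiff y k := by
  cases n with
  | zero => exact k.elim0
  | succ n =>
    refine Fin.cases ?_ (fun j => ?_) k
    · simp
    · simp only [succDiff_succ, Pi.add_apply]; abel

/-- `succDiff` commutes with scalars. [folklore] -/
theorem succDiff_smul {R α : Type*} [AddCommGroup α] [DistribSMul R α] (a : R) (x : Fin n → α)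
    (k : Fin n) : succDiff (a • x) k = a • succDiff x k := by
  cases n with
  | zero => exact k.elim0
  | succ n =>
    refine Fin.cases ?_ (fun j => ?_) k
    · simp
    · simp only [succDiff_succ, Pi.smul_apply, smul_sub]

/-- The forward tube `𝒯ₙ` is convex (it is the preimage of the convex cone `V₊ × ⋯ × V₊` under
the real-linear map `z ↦ (Im (z_k − z_{k-1}))_k`; Streater–Wightman (1964), §2-4). [cite: StreaterWightman1964, §2-4] -/
theorem convex_forwardTube : Convex ℝ (forwardTube d n) := by
  intro z hz w hw a b ha hb hab k
  have h := convex_forwardCone (d := d) (hz k) (hw k) ha hb hab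
  simpa [succDiff_add, succDiff_smul, imPart_smul_real] using h

variable (d n) in
/-- The open **time-ordered region** `Ω_< = {x | 0 < x₀⁰ < x₁⁰ < ⋯ < x_{n-1}⁰}` of Euclidean
configurations (Osterwalder–Schrader I (1973), §4, the region `ℝ^{4n}_<` carrying the test
functions `𝒮_<`; `AQFT.IsTimeOrdered F` says `tsupport F ⊆ Ω_<`). [cite: OsterwalderSchraderCMP1973, §4] -/
def timeOrderedRegion : Set (Fin n → EuclideanSpace ℝ (Fin (d + 1))) :=
  {x | (∀ i, 0 < x i 0) ∧ StrictMono fun i => x i 0}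

/-- `AQFT.IsTimeOrdered F` is `tsupport F ⊆ timeOrderedRegion d n` (definitional). [folklore] -/
theorem isTimeOrdered_iff {F : 𝓢((Fin n → EuclideanSpace ℝ (Fin (d + 1))), ℂ)} :
    QuantumLattice.IsTimeOrdered F ↔
      tsupport (F : (Fin n → EuclideanSpace ℝ (Fin (d + 1))) → ℂ) ⊆ timeOrderedRegion d n :=
  Iff.rfl

/-- The time-ordered region is open. [folklore] -/
theorem isOpen_timeOrderedRegion : IsOpen (timeOrderedRegion d n) := by
  have hc : ∀ i : Fin n, Continuous fun x : Fin n → EuclideanSpace ℝ (Fin (d + 1)) => x i 0 :=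
    fun i => (EuclideanSpace.proj (0 : Fin (d + 1))).continuous.comp (continuous_apply i)
  have h1 : IsOpen {x : Fin n → EuclideanSpace ℝ (Fin (d + 1)) | ∀ i, 0 < x i 0} := by
    rw [Set.setOf_forall]
    exact isOpen_iInter_of_finite fun i => isOpen_lt continuous_const (hc i)
  have h2 : IsOpen {x : Fin n → EuclideanSpace ℝ (Fin (d + 1)) | StrictMono fun i => x i 0} := by
    cases n with
    | zero =>
      have : {x : Fin 0 → EuclideanSpace ℝ (Fin (d + 1)) | StrictMono fun i => x i 0} = Set.univ :=
        Set.eq_univ_of_forall fun x => show StrictMono _ from Subsingleton.strictMono _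
      rw [this]
      exact isOpen_univ
    | succ m =>
      have : {x : Fin (m + 1) → EuclideanSpace ℝ (Fin (d + 1)) | StrictMono fun i => x i 0} =
          ⋂ i : Fin m, {x | x (Fin.castSucc i) 0 < x i.succ 0} := by
        ext x; simp [Fin.strictMono_iff_lt_succ]
      rw [this]
      exact isOpen_iInter_of_finite fun i => isOpen_lt (hc _) (hc _)
  exact h1.inter h2

/-- Positivity of all successive time differences (with `x_{-1}⁰ = 0`) is time-ordering. [folklore] -/
theorem mem_timeOrderedRegion_of_succDiff_pos {x : Fin n → EuclideanSpace ℝ (Fin (d + 1))}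
    (h : ∀ k, 0 < succDiff (fun i => x i 0) k) : x ∈ timeOrderedRegion d n := by
  cases n with
  | zero => exact ⟨fun i => i.elim0, Subsingleton.strictMono _⟩
  | succ m =>
    have hmono : StrictMono fun i : Fin (m + 1) => x i 0 := by
      refine Fin.strictMono_iff_lt_succ.2 fun i => ?_
      have := h i.succ
      rw [succDiff_succ] at this
      linarith
    have h0 : 0 < x 0 0 := by simpa using h 0
    exact ⟨fun i => h0.trans_le (hmono.monotone (Fin.zero_le i)), hmono⟩

/-- Time-ordered configurations have Euclidean points in the forward tube (restating
`euclideanPoint_mem_forwardTube` as a `Set.MapsTo`). [folklore] -/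
theorem mapsTo_euclideanPoint_timeOrderedRegion :
    Set.MapsTo (euclideanPoint (d := d) (n := n)) (timeOrderedRegion d n) (forwardTube d n) :=
  fun _ hx => euclideanPoint_mem_forwardTube hx.1 hx.2

/-- `x ↦ euclideanPoint x` is continuous. [folklore] -/
theorem continuous_euclideanPoint :
    Continuous (euclideanPoint :
      (Fin n → EuclideanSpace ℝ (Fin (d + 1))) → Fin n → Fin (d + 1) → ℂ) := by
  refine continuous_pi fun k => continuous_pi fun μ => ?_
  have hc : ∀ ν : Fin (d + 1),
      Continuous fun x : Fin n → EuclideanSpace ℝ (Fin (d + 1)) => (x k ν : ℂ) :=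
    fun ν => continuous_ofReal.comp ((EuclideanSpace.proj ν).continuous.comp (continuous_apply k))
  by_cases hμ : μ = 0
  · subst hμ
    simp only [euclideanPoint_apply_zero]
    exact continuous_const.mul (hc 0)
  · simp only [euclideanPoint, hμ, if_false]
    exact hc μ

/-- The *Euclidean real part* of a complex configuration `z ∈ (ℂ^{1+d})^n`: the Euclidean
configuration `x` with `x_k⁰ = Im z_k⁰`, `x⃗_k = Re z⃗_k`, so that `z = euclideanPoint x +
i • euclideanPoint y` with `y = euclideanIm z` (`euclideanPoint_euclideanRe_add`): the
Euclidean points form a maximal totally real subspace of `(ℂ^{1+d})^n`. [folklore] -/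
def euclideanRe (z : Fin n → Fin (d + 1) → ℂ) : Fin n → EuclideanSpace ℝ (Fin (d + 1)) :=
  fun k => WithLp.toLp 2 fun μ => if μ = 0 then (z k 0).im else (z k μ).re

/-- The *Euclidean imaginary part* of a complex configuration: `y_k⁰ = -Re z_k⁰`, `y⃗_k = Im z⃗_k`
(see `euclideanRe`). [folklore] -/
def euclideanIm (z : Fin n → Fin (d + 1) → ℂ) : Fin n → EuclideanSpace ℝ (Fin (d + 1)) :=
  fun k => WithLp.toLp 2 fun μ => if μ = 0 then -(z k 0).re else (z k μ).im

/-- Every complex configuration is `euclideanPoint x + i • euclideanPoint y` with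
`x = euclideanRe z`, `y = euclideanIm z`. [folklore] -/
theorem euclideanPoint_euclideanRe_add (z : Fin n → Fin (d + 1) → ℂ) :
    euclideanPoint (euclideanRe z) + (I : ℂ) • euclideanPoint (euclideanIm z) = z := by
  funext k μ
  by_cases hμ : μ = 0
  · subst hμ
    simp only [Pi.add_apply, Pi.smul_apply, euclideanPoint_apply_zero, euclideanRe, euclideanIm,
      smul_eq_mul]
    simp only [if_true]
    apply Complex.ext <;> simp
  · simp only [Pi.add_apply, Pi.smul_apply, euclideanPoint, hμ, if_false, euclideanRe, euclideanIm,
      smul_eq_mul, PiLp.toLp_apply]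
    apply Complex.ext <;> simp

/-- Real points of the complex line through two Euclidean points are Euclidean points:
`euclideanPoint x + t • euclideanPoint y = euclideanPoint (x + t • y)` for real `t`. [folklore] -/
theorem euclideanPoint_add_real_smul (x y : Fin n → EuclideanSpace ℝ (Fin (d + 1))) (t : ℝ) :
    euclideanPoint x + (t : ℂ) • euclideanPoint y = euclideanPoint (x + t • y) := by
  funext k μ
  by_cases hμ : μ = 0
  · subst hμ
    simp only [Pi.add_apply, Pi.smul_apply, euclideanPoint_apply_zero, smul_eq_mul, PiLp.add_apply,
      PiLp.smul_apply, smul_eq_mul]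
    push_cast; ring
  · simp only [Pi.add_apply, Pi.smul_apply, euclideanPoint, hμ, if_false, smul_eq_mul,
      PiLp.add_apply, PiLp.smul_apply]
    push_cast; ring

/-- The Euclidean real part of a point of the forward tube is time-ordered: its times are the
imaginary parts `Im z_k⁰`, whose successive differences are the time components of
`Im (z_k − z_{k-1}) ∈ V₊`. [folklore] -/
theorem euclideanRe_mem_timeOrderedRegion {z : Fin n → Fin (d + 1) → ℂ}
    (hz : z ∈ forwardTube d n) : euclideanRe z ∈ timeOrderedRegion d n := by
  refine mem_timeOrderedRegion_of_succDiff_pos fun k => ?_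
  have hk := ((mem_forwardCone_iff _).1 (hz k)).1
  cases n with
  | zero => exact k.elim0
  | succ m =>
    revert hk
    refine Fin.cases ?_ (fun j => ?_) k
    · intro hk; simpa [euclideanRe] using hk
    · intro hk; simpa [euclideanRe] using hk

/-! ### Time-ordered Euclidean points are a set of uniqueness for the forward tube -/

/-- **Identity theorem for the forward tube from Euclidean points.** A function holomorphic on
the forward tube `𝒯ₙ` which vanishes at all time-ordered Euclidean points vanishes identically
on `𝒯ₙ` (the Euclidean points are a *real environment* up to the linear change of variables
`z⁰ ↦ i z⁰`; Streater–Wightman (1964), §2-3, "a holomorphic function is determined by its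
values on a real environment"; Osterwalder–Schrader I (1973), §4). Elementary proof avoiding
several complex variables: write `z = p + i q` with `p = euclideanPoint (euclideanRe z)`
(time-ordered, in `𝒯ₙ`) and `q = euclideanPoint (euclideanIm z)`; on the complex line
`t ↦ p + t q` the set of parameters mapped into `𝒯ₙ` is open and convex (`convex_forwardTube`),
contains `0` and `i`, and `g (p + t q) = 0` for real `t` near `0` (these are time-ordered
Euclidean points), so the one-variable identity theorem gives `g z = g (p + i q) = 0`. [cite: StreaterWightman1964, §2-3] -/
theorem eqOn_zero_forwardTube_of_euclidean {g : (Fin n → Fin (d + 1) → ℂ) → ℂ}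
    (hg : DifferentiableOn ℂ g (forwardTube d n))
    (h0 : ∀ x ∈ timeOrderedRegion d n, g (euclideanPoint x) = 0) :
    Set.EqOn g 0 (forwardTube d n) := by
  intro z hz
  set x := euclideanRe z with hx_def
  set y := euclideanIm z with hy_def
  have hzxy : euclideanPoint x + (I : ℂ) • euclideanPoint y = z := euclideanPoint_euclideanRe_add z
  have hx : x ∈ timeOrderedRegion d n := euclideanRe_mem_timeOrderedRegion hz
  -- the complex line through `euclideanPoint x` in the direction `euclideanPoint y`
  set γ : ℂ → (Fin n → Fin (d + 1) → ℂ) := fun t => euclideanPoint x + t • euclideanPoint y with hγ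
  have hγd : Differentiable ℂ γ := (differentiable_const _).add (differentiable_id.smul_const _)
  set D : Set ℂ := γ ⁻¹' forwardTube d n with hD
  have hDo : IsOpen D := isOpen_forwardTube.preimage hγd.continuous
  have hDc : Convex ℝ D := by
    intro s hs t ht a b ha hb hab
    show γ (a • s + b • t) ∈ forwardTube d n
    have hab' : (a : ℂ) + b = 1 := by exact_mod_cast hab
    have : γ (a • s + b • t) = a • γ s + b • γ t := by
      funext k μ
      simp only [hγ, Pi.add_apply, Pi.smul_apply, smul_eq_mul, Complex.real_smul]
      linear_combination (euclideanPoint x k μ) * hab'.symm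
    rw [this]
    exact convex_forwardTube hs ht ha hb hab
  have h0D : (0 : ℂ) ∈ D := by
    show γ 0 ∈ forwardTube d n
    simp only [hγ, zero_smul, add_zero]
    exact euclideanPoint_mem_forwardTube hx.1 hx.2
  have hID : I ∈ D := by
    show γ I ∈ forwardTube d n
    simpa only [hγ, hzxy] using hz
  -- the restriction of `g` to the line is analytic on `D` …
  have hφ : AnalyticOnNhd ℂ (g ∘ γ) D :=
    (hg.comp hγd.differentiableOn (Set.mapsTo_preimage γ _)).analyticOnNhd hDo
  -- … and vanishes at the real parameters near `0`
  have hreal : ∀ᶠ t : ℝ in 𝓝 0, (g ∘ γ) (t : ℂ) = 0 := by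
    have hcont : Continuous fun t : ℝ => x + t • y :=
      continuous_const.add (continuous_id.smul continuous_const)
    have hmem : ∀ᶠ t : ℝ in 𝓝 0, x + t • y ∈ timeOrderedRegion d n := by
      refine hcont.continuousAt.eventually_mem (isOpen_timeOrderedRegion.mem_nhds ?_)
      simpa using hx
    filter_upwards [hmem] with t ht
    simp only [Function.comp_apply, hγ, euclideanPoint_add_real_smul]
    exact h0 _ ht
  have hfreq : ∃ᶠ t in 𝓝[≠] (0 : ℂ), (g ∘ γ) t = 0 := by
    have htend : Tendsto (fun t : ℝ => (t : ℂ)) (𝓝[≠] 0) (𝓝[≠] 0) := by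
      refine (continuous_ofReal.continuousWithinAt).tendsto_nhdsWithin ?_
      intro t ht
      simpa using ht
    exact htend.frequently (eventually_nhdsWithin_of_eventually_nhds hreal).frequently
  have := hφ.eqOn_zero_of_preconnected_of_frequently_eq_zero hDc.isPreconnected h0D hfreq hID
  simp only [Function.comp_apply, hγ, hzxy, Pi.zero_apply] at this
  simpa only [Pi.zero_apply] using this

/-- Two functions holomorphic on the forward tube which agree at all time-ordered Euclidean
points agree on the whole tube (`eqOn_zero_forwardTube_of_euclidean` for the difference). [cite: StreaterWightman1964, §2-3] -/
theorem eqOn_forwardTube_of_euclidean {𝔚 𝔚' : (Fin n → Fin (d + 1) → ℂ) → ℂ}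
    (h𝔚 : DifferentiableOn ℂ 𝔚 (forwardTube d n))
    (h𝔚' : DifferentiableOn ℂ 𝔚' (forwardTube d n))
    (heq : ∀ x ∈ timeOrderedRegion d n, 𝔚 (euclideanPoint x) = 𝔚' (euclideanPoint x)) :
    Set.EqOn 𝔚 𝔚' (forwardTube d n) := by
  intro z hz
  have := eqOn_zero_forwardTube_of_euclidean (h𝔚.sub h𝔚') (fun x hx => by
    simp [heq x hx]) hz
  simpa [sub_eq_zero] using this

/-! ### From equal Euclidean integrals to pointwise equality on the time-ordered region -/

/-- A function continuous on an open set `U`, multiplied by a continuous function whose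
topological support lies in `U`, is continuous everywhere. [folklore] -/
theorem continuous_mul_of_tsupport_subset {X : Type*} [TopologicalSpace X] {U : Set X}
    (hU : IsOpen U) {G φ : X → ℂ} (hG : ContinuousOn G U) (hφ : Continuous φ)
    (hsupp : tsupport φ ⊆ U) : Continuous fun x => G x * φ x := by
  refine continuous_iff_continuousAt.2 fun x => ?_
  by_cases hx : x ∈ tsupport φ
  · exact (hG.continuousAt (hU.mem_nhds (hsupp hx))).mul hφ.continuousAt
  · have hφ0 : φ =ᶠ[𝓝 x] 0 := notMem_tsupport_iff_eventuallyEq.1 hx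
    refine Filter.EventuallyEq.continuousAt (y := 0) ?_
    filter_upwards [hφ0] with y hy
    simp [hy]

/-- Two functions continuous on the time-ordered region `Ω_<` with the same integrals against
all time-ordered Schwartz test functions agree on `Ω_<`: test against complexified smooth bump
functions supported in `Ω_<` (which are time-ordered Schwartz functions,
`HasCompactSupport.toSchwartzMap`), conclude a.e. equality on `Ω_<` (Mathlib
`IsOpen.ae_eq_zero_of_integral_contDiff_smul_eq_zero`) and use that Lebesgue measure charges
open sets (`Measure.eqOn_open_of_ae_eq`). [folklore] -/
theorem eqOn_timeOrderedRegion_of_integral_eq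
    {G G' : (Fin n → EuclideanSpace ℝ (Fin (d + 1))) → ℂ}
    (hG : ContinuousOn G (timeOrderedRegion d n)) (hG' : ContinuousOn G' (timeOrderedRegion d n))
    (h : ∀ F : 𝓢((Fin n → EuclideanSpace ℝ (Fin (d + 1))), ℂ), QuantumLattice.IsTimeOrdered F →
      ∫ x, G x * F x = ∫ x, G' x * F x) :
    Set.EqOn G G' (timeOrderedRegion d n) := by
  have hU : IsOpen (timeOrderedRegion d n) := isOpen_timeOrderedRegion
  have hf : ContinuousOn (fun x => G x - G' x) (timeOrderedRegion d n) := hG.sub hG'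
  have hae : ∀ᵐ x ∂(volume : Measure (Fin n → EuclideanSpace ℝ (Fin (d + 1)))),
      x ∈ timeOrderedRegion d n → G x - G' x = 0 := by
    refine hU.ae_eq_zero_of_integral_contDiff_smul_eq_zero
      (hf.locallyIntegrableOn hU.measurableSet) fun g hg hgs hgU => ?_
    have hgs' : HasCompactSupport fun x => (g x : ℂ) := hgs.comp_left Complex.ofReal_zero
    have hgd' : ContDiff ℝ (⊤ : ℕ∞) fun x => (g x : ℂ) := ofRealCLM.contDiff.comp hg
    have hsupp : tsupport (fun x => (g x : ℂ)) ⊆ timeOrderedRegion d n :=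
      (tsupport_comp_subset Complex.ofReal_zero g).trans hgU
    have hto : QuantumLattice.IsTimeOrdered (hgs'.toSchwartzMap hgd') := fun x hx => hsupp hx
    have hint := h _ hto
    have hI : ∀ {H : (Fin n → EuclideanSpace ℝ (Fin (d + 1))) → ℂ},
        ContinuousOn H (timeOrderedRegion d n) → Integrable fun x => H x * (g x : ℂ) :=
      fun hH => (continuous_mul_of_tsupport_subset hU hH hgd'.continuous hsupp)
        |>.integrable_of_hasCompactSupport hgs'.mul_left
    calc ∫ x, g x • (G x - G' x) = ∫ x, (G x * (g x : ℂ) - G' x * (g x : ℂ)) := by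
          congr 1; funext x; rw [Complex.real_smul]; ring
      _ = (∫ x, G x * (g x : ℂ)) - ∫ x, G' x * (g x : ℂ) := integral_sub (hI hG) (hI hG')
      _ = 0 := by rw [sub_eq_zero]; exact hint
  have hae' : (fun x => G x - G' x) =ᵐ[volume.restrict (timeOrderedRegion d n)] 0 := by
    rw [Filter.EventuallyEq, ae_restrict_iff' hU.measurableSet]
    exact hae
  intro x hx
  exact sub_eq_zero.1 (Measure.eqOn_open_of_ae_eq hae' hU hf continuousOn_const hx)

/-! ### Boundary values only see the tube -/

/-- A canonical direction in the base cone of the forward tube: `η_k = (k + 1) e₀`, whose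
successive differences are all `e₀ ∈ V₊`; in particular `tubeCone d n` is nonempty. [folklore] -/
theorem stdDirection_mem_tubeCone :
    (fun k : Fin n => (((k : ℕ) : ℝ) + 1) • e₀ d) ∈ tubeCone d n := by
  intro k
  rw [succDiff_map (fun t : ℝ => t • e₀ d) (fun a b => sub_smul a b _),
    smul_e₀_mem_forwardCone_iff]
  cases n with
  | zero => exact k.elim0
  | succ m =>
    refine Fin.cases ?_ (fun j => ?_) k
    · simp
    · simp only [succDiff_succ, Fin.val_succ, Fin.val_castSucc]
      push_cast
      linarith

/-- Distributional boundary values depend only on the values of the holomorphic function on the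
forward tube: two functions agreeing on `𝒯ₙ` with boundary values `T`, `T'` have `T = T'`
(the rays `x + i t η`, `t > 0`, lie in `𝒯ₙ`, and limits along `t → 0⁺` are unique). [folklore] -/
theorem _root_.Literature.MathematicalPhysics.QuantumLattice.HasDistributionalBoundaryValue.eq_of_eqOn {𝔚 𝔚' : (Fin n → Fin (d + 1) → ℂ) → ℂ}
    {T T' : 𝓢((Fin n → SpaceTime d), ℂ) →L[ℂ] ℂ} (h : HasDistributionalBoundaryValue 𝔚 T)
    (h' : HasDistributionalBoundaryValue 𝔚' T') (heq : Set.EqOn 𝔚 𝔚' (forwardTube d n)) :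
    T = T' := by
  refine ContinuousLinearMap.ext fun F => ?_
  set η₀ : Fin n → SpaceTime d := fun k => (((k : ℕ) : ℝ) + 1) • e₀ d
  have hη₀ : η₀ ∈ tubeCone d n := stdDirection_mem_tubeCone
  refine tendsto_nhds_unique_of_eventuallyEq (h η₀ hη₀ F) (h' η₀ hη₀ F) ?_
  refine eventually_nhdsWithin_of_forall fun t (ht : 0 < t) => ?_
  show (∫ x, _) = ∫ x, _
  congr 1
  funext x
  rw [heq (mem_forwardTube_of_mem_tubeCone x η₀ hη₀ ht)]

end Literature.MathematicalPhysics.QuantumFieldTheory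

/-! ### The discharge of `wightmanFn_eq_of_isWickRotationOf` -/

namespace Literature.MathematicalPhysics.QuantumFieldTheory

/-- **Discharge of `wightmanFn_eq_of_isWickRotationOf`** (Osterwalder–Schrader I (1973), §4:
the Schwinger functions on `𝒮_<` determine the Wightman distributions; Streater–Wightman
(1964), §2-3 (real environments), §3-3/§3-4). If `S` is the Wick rotation of both `W` and
`W'`, then for each `n` the two holomorphic functions `𝔚ₙ`, `𝔚ₙ'` on `𝒯ₙ` have equal
integrals against every time-ordered test function at Euclidean points, hence agree at all
time-ordered Euclidean points (`eqOn_timeOrderedRegion_of_integral_eq`; both are continuous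
there), hence on the whole forward tube (`eqOn_forwardTube_of_euclidean`), hence have the same
distributional boundary value (`HasDistributionalBoundaryValue.eq_of_eqOn`), which on a
tensor test function `f₁ ⊗ ⋯ ⊗ fₙ` (`AQFT.exists_isTensorOf`) is the smeared Wightman function
of `W`, respectively `W'`. [cite: OsterwalderSchraderCMP1973, §4] -/
theorem wightmanFn_eq_of_isWickRotationOf_holds : wightmanFn_eq_of_isWickRotationOf := by
  intro d S W W' h h' n f
  obtain ⟨𝔚, h𝔚, ⟨T, hT, hbv⟩, hS⟩ := h n
  obtain ⟨𝔚', h𝔚', ⟨T', hT', hbv'⟩, hS'⟩ := h' n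
  have hE : Set.EqOn (fun x => 𝔚 (euclideanPoint x)) (fun x => 𝔚' (euclideanPoint x))
      (timeOrderedRegion d n) := by
    refine eqOn_timeOrderedRegion_of_integral_eq
      (h𝔚.continuousOn.comp continuous_euclideanPoint.continuousOn
        mapsTo_euclideanPoint_timeOrderedRegion)
      (h𝔚'.continuousOn.comp continuous_euclideanPoint.continuousOn
        mapsTo_euclideanPoint_timeOrderedRegion) fun F hF => ?_
    rw [← hS F hF, ← hS' F hF]
  have hTT' : T = T' := hbv.eq_of_eqOn hbv' (eqOn_forwardTube_of_euclidean h𝔚 h𝔚' hE)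
  obtain ⟨F, hF⟩ := QuantumLattice.exists_isTensorOf f
  rw [← hT f F hF, ← hT' f F hF, hTT']

end Literature.MathematicalPhysics.QuantumFieldTheory
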